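/-
Copyright (c) 2026 the pub-hodgecm-mathlib formalisation cell (harness21).  Prover seat hodgecm-mathlib-K2E4-p10 (g6), Track B ∕ K2-LIT, h413 =
`stmt-HodgeConjecture-24833`, line `K2_E1_TraceFormulaBeta`, campaign «EIS-R7-BL-SPH-3», letter (L4b) = (RES) «THE RESIDUE AT `2ρ_H` IS THE CONSTANT `φ₀·r`» of ★ p859395
(`K2E1SphericalEisensteinRegularRemainderCMThreeOfLetters.hreg_cm_three_of_letters`, binder `hres`) — «ROAD B PAYS INTO THE CAPSTONE» (dealer K2E1-plan (g6) (75), 2026-09-04T10:28:27Z).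
-/
import Summits.HodgeConjecture.HodgeConjecture.Theorems.K2E1SphericalEisensteinRegularRemainderCMThreeOfLetters   -- ★ p859395 (this seat): the `hres` binder's bytes; brings ★ bricks p859366, the capstone₃ skeleton ★ p859307
import Summits.HodgeConjecture.HodgeConjecture.Theorems.K2E1CuspFormsMeanZeroSoftUCM                              -- ★ p859288 (this seat): `integral_eq_zero_of_mem_cuspForms_cm_three` (ROAD B, letter-free «cusp forms have mean zero»)
import Mathlib.Analysis.Analytic.IsolatedZeros
import HarnessLib

/-!
# K2·E1 — `K2E1SphericalEisensteinResidueConstantCMThreeOfLetters`: LANGLANDS' «THE RESIDUE OF THE SPHERICAL EISENSTEIN SERIES OF `U(2,1)` AT `z = 2ρ_H = 2` IS THE CONSTANT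
# FUNCTION `φ₀·r`» — the letter (RES) of the regular-remainder payer ★ p859395, from the `L²` residue class by «cusp forms have mean zero» (★ ROAD B) and the pointwise link

Track B ∕ K2-LIT, crux h413 = `stmt-HodgeConjecture-24833`, route of record `HCCMUnconditional`; cell `hodgecm-mathlib`, squad K2, ENGINE E1, campaign EIS-R7-BL-SPH-3 (R31).  Prover seat
`hodgecm-mathlib-K2E4-p10` (g6); RULING (75) of the dealer K2E1-plan (g6) («(L4b) `hres2` payer = YOUR next file»).  THEOREMS ONLY (no `def`, no `instance`, no notation, no named-fact
hypothesis, no `sorry`); lane `--supports stmt-HodgeConjecture-24833 --as helper` (count-neutral).  Closes no socket.  §1–§3 are generic (pure analysis ∕ any adelic group datum); §4 is the CM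
`N = 3` print in the exact bytes of ★ p859395's binder `hres`.

THE MATHEMATICS ([Langlands1976, §7]; [MoeglinWaldspurger1995, IV.1.11, IV.3.12 (b)]; [BernsteinLapid2019, §4]).  Near `ρ₀ = 2` the continued point values `Ẽ(z)(g)` and the
constant-term scalar `c̃(z)` have (at most) simple poles: `F_g(z) := (z−2)·Ẽ(z)(g)` and `C(z) := (z−2)·c̃(z)` extend analytically over `2`, `C(2) = r`.  The remainder
`r_g(z) = Ẽ(z)(g) − φ₀·(H(g)^z + c̃(z)·H(g)^{2−z}) = N_g(z)∕(z−2)`, `N_g(z) := F_g(z) − φ₀·((z−2)·H(g)^z + C(z)·H(g)^{2−z})` analytic with `N_g(2) = F_g(2) − φ₀·r`, is therefore REGULAR AT `2`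
iff **`F_g(2) = φ₀·r` for every `g`: the residue of the Eisenstein series at `2ρ_H` is the CONSTANT function `φ₀·r`** (§1: `r_g = dslope N_g 2` off `2`).  THE IDENTIFICATION (§2–§3): the residue
CLASS `Res ∈ L²(𝔛)` (the limit of `(z−2)·Ẽ(z)` in `𝓗`) is orthogonal to `L²_cusp` (continuation of `⟪φ, Ẽ(z)⟫ = 0`, ★ P7 FILE A, from the Godement tube) and `Res − φ₀r·𝟙` lies IN
`L²_cusp` (its constant term vanishes — the continued constant-term identity (Ξ₂)₃ gives `(Res)_B = φ₀·r·H^0` — and the square-integrable pseudo-Eisenstein series are dense in `(L²_cusp)ᗮ`, ★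
`cmCuspidalSubspaceR_orthogonal_eq_topologicalClosure_span_three`); since ALSO `𝟙 ⊥ L²_cusp` — «CUSP FORMS HAVE MEAN ZERO», ★ ROAD B `integral_eq_zero_of_mem_cuspForms_cm_three` (this seat,
p859288) — the vector `Res − φ₀r·𝟙` is cuspidal AND orthogonal to the cuspidal subspace, hence `0`: **`Res = φ₀r·𝟙` in `L²`**; the pointwise values follow through the bounded evaluation
functionals `Λ_g` of ★ P3-D (`ĥ(z)·Ẽ(z)(g) = Λ_g(Ẽ(z))`, so `ĥ(2)·F_g(2) = Λ_g(Res) = φ₀r·Λ_g(𝟙) = φ₀r·∫h`) and the symmetry `ĥ(2) = ĥ(0) = ∫ h` of the spherical transform (letter `hsym`;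
classical from the intertwining identity ★ `intertwinedCoeff_const`).
* §1 (scalar) `exists_analyticAt_eventuallyEq_mul_sub_of_tendsto` (`(z−ρ₀)·c̃` extends over `ρ₀` with value `r`, from `hchol hcres` — ★ brick), **`exists_analyticAt_eventuallyEq_remainder_of_residue`**
  (`F_g(ρ₀) = φ₀·r` ⟹ the (RES) letter at `g`, via `dslope`).
* §2 (any `𝒢`, automorphic `μ`, any `𝔓`) **`eq_smul_const_of_mem_orthogonal_of_sub_mem`** — `hmean` + `v ∈ (L²_cusp)ᗮ` + `v − κ·𝟙 ∈ L²_cusp` ⟹ `v = κ·𝟙`;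
  `mem_orthogonal_cuspidalSubspace_of_forall_inner_eq_zero`; `mem_of_orthogonal_eq_topologicalClosure_span` (membership in a closed `K` from orthogonality to a set spanning `Kᗮ` densely).
* §3 (any normed space) **`value_eq_of_repr_of_tendsto`** — the pointwise value from the class: `a(z)·F(z) = Λ(V z)` near `ρ₀`, `V → w = κ·e`, `Λ e = a(ρ₀) ≠ 0` ⟹ `F(ρ₀) = κ`.
* §4 THE CM PRINT **`hres_cm_three_of_letters`** — the binder `hres` of ★ `hreg_cm_three_of_letters` VERBATIM, from: (L3) `hchol hcres`; (F) the per-`g` analytic `F_g =ᶠ (z−2)·Ẽ(z)(g)` (payer: ★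
  bricks §1 + the MS letter near `2`); the CLASS letters `Fres ∈ (L²_cusp)ᗮ` (continued orthogonality, operator road (66)) and `Fres − (φ₀r)·𝟙 ∈ L²_cusp` (continued constant term (E3′) + ★
  density — §2 reduces it to generator-orthogonality); the LINK letter per `g` (★ P3-D `Λ_g`, ★ P5 `ĥ` with `ĥ(2) ≠ 0`, the `𝓗`-valued family `V z = (z−2)•vX z → Fres` of (38b)∕(60), the
  representation `ĥ(z)·F_g(z) = Λ_g(V z)`, and `hsym : Λ_g 𝟙 = ĥ(2)`); and — DISCHARGED HERE — «cusp forms have mean zero» ★ p859288.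
HONEST LABEL: HC_CM is proved only modulo the 7 printed citations (2 remaining named inputs: hLiu418 = `stmt-HodgeConjecture-24832`, h413 = `stmt-HodgeConjecture-24833`) until rung 0
closes; this file asserts no named fact and closes no socket; §4 is CONDITIONAL on the letters named above.
References: [Langlands1976] R. P. Langlands, *On the functional equations satisfied by Eisenstein series*, LNM 544 (1976), §7 · [MoeglinWaldspurger1995] IV.1.11, IV.3.12 ·
[BernsteinLapid2019] §4 · [Garrett2018] §1.12, §11.3 · [BorelJacquet1979] §4.6.
-/

set_option autoImplicit false
-- the mandated namespace repeats the single-problem summit's segment (`HodgeConjecture.HodgeConjecture`)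
set_option linter.dupNamespace false

noncomputable section

open MeasureTheory Measure NumberField IsDedekindDomain Set Filter Topology ContRepresentation
open scoped ENNReal NNReal InnerProductSpace
open Literature.NumberTheory.Automorphic Literature.NumberTheory.Automorphic.UnitaryGroup AdelicGroupData
open Summit.HodgeConjecture.HodgeConjecture.Cruxes.H413.K2E1BorelEisensteinU
open Summit.HodgeConjecture.HodgeConjecture.Cruxes.H413.K2E1BLRemovablePolesU (exists_analyticAt_eventuallyEq_of_differentiableAt_of_eventually_norm_le)
open Summit.HodgeConjecture.HodgeConjecture.Cruxes.H413.K2E1ConstantLineResidualU2 (cuspidalSubspace_le_orthogonal_span_const)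
open Summit.HodgeConjecture.HodgeConjecture.Cruxes.H413.K2E1CuspFormsMeanZeroSoftU (cuspidalSubspace_le_orthogonal_span_of_forall_inner_eq_zero)
open Summit.HodgeConjecture.HodgeConjecture.Cruxes.H413.K2E1CuspFormsMeanZeroSoftUCM (integral_eq_zero_of_mem_cuspForms_cm_three)

namespace Summit.HodgeConjecture.HodgeConjecture.Cruxes.H413.K2E1SphericalEisensteinResidueConstantCMThreeOfLetters

/-! ## §1 Scalar glue: simple poles multiplied out, and the remainder through `dslope` -/

section Scalar

/-- **`(z − ρ₀)·c̃(z)` EXTENDS ANALYTICALLY OVER `ρ₀` WITH VALUE `r`**, for `c̃` holomorphic on `U ∖ {ρ₀}` (`U ∈ 𝓝 ρ₀`) with `(z − ρ₀)·c̃(z) → r` (bounded near `ρ₀`, ★ brick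
`exists_analyticAt_eventuallyEq_of_differentiableAt_of_eventually_norm_le`; the value by uniqueness of limits). [cite: MoeglinWaldspurger1995, IV.1.11] -/
theorem exists_analyticAt_eventuallyEq_mul_sub_of_tendsto {cc : ℂ → ℂ} {U : Set ℂ} {ρ₀ r : ℂ} (hU : U ∈ 𝓝 ρ₀) (hchol : DifferentiableOn ℂ cc (U \ {ρ₀}))
    (hcres : Tendsto (fun z : ℂ => (z - ρ₀) * cc z) (𝓝[≠] ρ₀) (𝓝 r)) :
    ∃ C : ℂ → ℂ, AnalyticAt ℂ C ρ₀ ∧ C =ᶠ[𝓝[≠] ρ₀] (fun z => (z - ρ₀) * cc z) ∧ C ρ₀ = r := by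
  -- differentiable on a punctured neighbourhood
  have hd : ∀ᶠ z in 𝓝[≠] ρ₀, DifferentiableAt ℂ (fun z => (z - ρ₀) * cc z) z := by
    obtain ⟨V, hVU, hVo, hρV⟩ := mem_nhds_iff.1 hU
    have hn : ∀ᶠ z in 𝓝[≠] ρ₀, z ∈ V ∧ z ≠ ρ₀ := by
      filter_upwards [mem_nhdsWithin_of_mem_nhds (hVo.mem_nhds hρV), self_mem_nhdsWithin] with z hz hz'
      exact ⟨hz, hz'⟩
    filter_upwards [hn] with z hz
    have hopen : IsOpen (V \ {ρ₀}) := hVo.sdiff isClosed_singleton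
    have hcz : DifferentiableAt ℂ cc z := (hchol.mono fun x hx => ⟨hVU hx.1, hx.2⟩).differentiableAt (hopen.mem_nhds ⟨hz.1, hz.2⟩)
    exact (differentiableAt_id.sub (differentiableAt_const ρ₀)).mul hcz
  -- bounded near `ρ₀` (it converges)
  have hb : ∃ M : ℝ, ∀ᶠ z in 𝓝[≠] ρ₀, ‖(z - ρ₀) * cc z‖ ≤ M :=
    ⟨‖r‖ + 1, (hcres.norm.eventually (Iio_mem_nhds (lt_add_one ‖r‖))).mono fun z hz => hz.le⟩
  obtain ⟨C, hC, hCf⟩ := exists_analyticAt_eventuallyEq_of_differentiableAt_of_eventually_norm_le hd hb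
  refine ⟨C, hC, hCf, ?_⟩
  have h1 : Tendsto C (𝓝[≠] ρ₀) (𝓝 (C ρ₀)) := hC.continuousAt.continuousWithinAt.tendsto
  exact tendsto_nhds_unique h1 (hcres.congr' hCf.symm)

/-- **THE REMAINDER IS REGULAR AT `ρ₀` WHEN THE RESIDUE IS `φ₀·r`.**  Let `F =ᶠ (z − ρ₀)·Ec z` near `ρ₀` with `F` analytic at `ρ₀` and `F ρ₀ = φ₀·r` (the residue of the point value), `c̃`
holomorphic on `U ∖ {ρ₀}` with `(z − ρ₀)·c̃ z → r`, and `h > 0`.  Then `z ↦ Ec z − φ₀·(h^z + c̃ z·h^{ρ₀−z})` agrees near `ρ₀` (off `ρ₀`) with a function ANALYTIC at `ρ₀` — namely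
`dslope N ρ₀`, `N z = F z − φ₀·((z−ρ₀)h^z + C z h^{ρ₀−z})`, `N ρ₀ = F ρ₀ − φ₀ r = 0`. [cite: MoeglinWaldspurger1995, IV.1.11 and IV.3.12] [cite: Langlands1976, §7] -/
theorem exists_analyticAt_eventuallyEq_remainder_of_residue {Ec F cc : ℂ → ℂ} {U : Set ℂ} {ρ₀ r : ℂ} (φ₀ : ℂ) {h : ℝ} (hh : 0 < h)
    (hF : AnalyticAt ℂ F ρ₀) (hFE : F =ᶠ[𝓝[≠] ρ₀] fun z => (z - ρ₀) * Ec z) (hFval : F ρ₀ = φ₀ * r)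
    (hU : U ∈ 𝓝 ρ₀) (hchol : DifferentiableOn ℂ cc (U \ {ρ₀})) (hcres : Tendsto (fun z : ℂ => (z - ρ₀) * cc z) (𝓝[≠] ρ₀) (𝓝 r)) :
    ∃ G : ℂ → ℂ, AnalyticAt ℂ G ρ₀ ∧ G =ᶠ[𝓝[≠] ρ₀] (fun z => Ec z - φ₀ * (((h : ℝ) : ℂ) ^ z + cc z * ((h : ℝ) : ℂ) ^ (ρ₀ - z))) := by
  obtain ⟨C, hC, hCf, hCval⟩ := exists_analyticAt_eventuallyEq_mul_sub_of_tendsto hU hchol hcres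
  have hsl : ((h : ℝ) : ℂ) ∈ Complex.slitPlane := Complex.ofReal_mem_slitPlane.2 hh
  have hp1 : AnalyticAt ℂ (fun z : ℂ => ((h : ℝ) : ℂ) ^ z) ρ₀ := analyticAt_const.cpow analyticAt_id hsl
  have hp2 : AnalyticAt ℂ (fun z : ℂ => ((h : ℝ) : ℂ) ^ (ρ₀ - z)) ρ₀ := analyticAt_const.cpow (analyticAt_const.sub analyticAt_id) hsl
  -- the numerator `N`, analytic at `ρ₀` with `N ρ₀ = 0`
  set Nf : ℂ → ℂ := fun z => F z - φ₀ * ((z - ρ₀) * ((h : ℝ) : ℂ) ^ z + C z * ((h : ℝ) : ℂ) ^ (ρ₀ - z)) with hNf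
  have hN : AnalyticAt ℂ Nf ρ₀ := hF.sub (analyticAt_const.mul (((analyticAt_id.sub analyticAt_const).mul hp1).add (hC.mul hp2)))
  have hN0 : Nf ρ₀ = 0 := by
    simp only [hNf, sub_self, zero_mul, zero_add, Complex.cpow_zero, mul_one, hFval, hCval]
  obtain ⟨p, hp⟩ := hN
  refine ⟨dslope Nf ρ₀, ⟨_, hp.has_fpower_series_dslope_fslope⟩, ?_⟩
  filter_upwards [hFE, hCf, self_mem_nhdsWithin] with z hzF hzC hz
  have hz' : z - ρ₀ ≠ 0 := sub_ne_zero.2 hz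
  rw [dslope_of_ne _ hz, slope, hN0, vsub_eq_sub, sub_zero, smul_eq_mul]
  show (z - ρ₀)⁻¹ * (F z - φ₀ * ((z - ρ₀) * ((h : ℝ) : ℂ) ^ z + C z * ((h : ℝ) : ℂ) ^ (ρ₀ - z))) = _
  rw [hzF, hzC]
  field_simp

end Scalar

/-! ## §2 The `L²` identification: `Res ⊥ L²_cusp`, `Res − κ·𝟙 ∈ L²_cusp`, cusp forms have mean zero ⟹ `Res = κ·𝟙` -/

section Hilbert

universe u

variable {K : Type} [Field K] [NumberField K] (𝒢 : AdelicGroupData.{u} K) (μ : Measure 𝒢.automorphicQuotient) [𝒢.IsAutomorphicMeasure μ] (𝔓 : 𝒢.ParabolicUnipotentData)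

/-- **`Res = κ·𝟙`.**  If cusp forms have mean zero (`hmean`: so `𝟙 ⊥ L²_cusp`, ★ `cuspidalSubspace_le_orthogonal_span_const`), a vector `v ∈ (L²_cusp)ᗮ` with `v − κ·𝟙 ∈ L²_cusp` satisfies
`v = κ·𝟙`: `v − κ·𝟙` is cuspidal and orthogonal to the cuspidal subspace. [cite: Langlands1976, §7] [cite: MoeglinWaldspurger1995, IV.1.11] [cite: BorelJacquet1979, §4.6] -/
theorem eq_smul_const_of_mem_orthogonal_of_sub_mem (hmean : ∀ φ ∈ 𝒢.cuspForms μ 𝔓, ∫ x, φ x ∂μ = 0) {v : 𝒢.L2 μ} {κ : ℂ}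
    (hv : v ∈ (𝒢.cuspidalSubspace μ 𝔓).toSubmoduleᗮ) (hsub : v - κ • (Lp.const 2 μ (1 : ℂ) : 𝒢.L2 μ) ∈ (𝒢.cuspidalSubspace μ 𝔓).toSubmodule) :
    v = κ • (Lp.const 2 μ (1 : ℂ) : 𝒢.L2 μ) := by
  have h1 : (Lp.const 2 μ (1 : ℂ) : 𝒢.L2 μ) ∈ (𝒢.cuspidalSubspace μ 𝔓).toSubmoduleᗮ :=
    Submodule.orthogonal_le (cuspidalSubspace_le_orthogonal_span_const 𝒢 μ 𝔓 hmean)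
      (Submodule.le_orthogonal_orthogonal _ (Submodule.mem_span_singleton_self _))
  have hw : v - κ • (Lp.const 2 μ (1 : ℂ) : 𝒢.L2 μ) ∈ (𝒢.cuspidalSubspace μ 𝔓).toSubmoduleᗮ := Submodule.sub_mem _ hv (Submodule.smul_mem _ κ h1)
  have h0 := Submodule.inner_right_of_mem_orthogonal hsub hw
  rwa [inner_self_eq_zero, sub_eq_zero] at h0

/-- **`v ∈ (L²_cusp)ᗮ` from orthogonality to the CUSP FORMS** (the generators; closure ★ `cuspidalSubspace_le_orthogonal_span_of_forall_inner_eq_zero`). [cite: BorelJacquet1979, §4.6] -/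
theorem mem_orthogonal_cuspidalSubspace_of_forall_inner_eq_zero (v : 𝒢.L2 μ) (horth : ∀ φ : ↥(𝒢.cuspForms μ 𝔓), ⟪v, 𝒢.cuspFormsToLp μ 𝔓 φ⟫_ℂ = 0) :
    v ∈ (𝒢.cuspidalSubspace μ 𝔓).toSubmoduleᗮ :=
  Submodule.orthogonal_le (cuspidalSubspace_le_orthogonal_span_of_forall_inner_eq_zero 𝒢 μ 𝔓 v horth)
    (Submodule.le_orthogonal_orthogonal _ (Submodule.mem_span_singleton_self _))

omit [𝒢.IsAutomorphicMeasure μ] in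
/-- **MEMBERSHIP IN A CLOSED SUBSPACE FROM ORTHOGONALITY TO A DENSE SPANNING SET OF ITS COMPLEMENT**: if `Kᗮ` is the closure of the span of `𝒮` (★ density
`cmCuspidalSubspaceR_orthogonal_eq_topologicalClosure_span_three` for `K = L²_cusp(U(Φ₃))`, `𝒮` = square-integrable pseudo-Eisenstein series) and `⟪s, w⟫ = 0` for all `s ∈ 𝒮`, then `w ∈ K`.
[cite: MoeglinWaldspurger1995, II.1.2–II.1.4] -/
theorem mem_of_orthogonal_eq_topologicalClosure_span {W : Submodule ℂ (𝒢.L2 μ)} [W.HasOrthogonalProjection] {𝒮 : Set (𝒢.L2 μ)}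
    (hW : Wᗮ = (Submodule.span ℂ 𝒮).topologicalClosure) {w : 𝒢.L2 μ} (h : ∀ s ∈ 𝒮, ⟪s, w⟫_ℂ = 0) : w ∈ W := by
  have h1 : Submodule.span ℂ 𝒮 ≤ (ℂ ∙ w)ᗮ := Submodule.span_le.2 fun s hs => Submodule.mem_orthogonal_singleton_iff_inner_left.2 (h s hs)
  have h2 : Wᗮ ≤ (ℂ ∙ w)ᗮ := by
    rw [hW]
    exact Submodule.topologicalClosure_minimal _ h1 (Submodule.isClosed_orthogonal _)
  have h3 : (ℂ ∙ w) ≤ W := by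
    rw [← Submodule.orthogonal_orthogonal W]
    exact (Submodule.le_orthogonal_orthogonal _).trans (Submodule.orthogonal_le h2)
  exact h3 (Submodule.mem_span_singleton_self _)

end Hilbert

/-! ## §3 The pointwise value from the class -/

section Pointwise

/-- **THE POINTWISE RESIDUE FROM THE RESIDUE CLASS**: if `a(z)·F(z) = Λ(V z)` near `ρ₀` (off `ρ₀`) for a bounded functional `Λ`, with `a, F` continuous at `ρ₀`, `V z → w = κ·e` and
`Λ e = a(ρ₀) ≠ 0` (for the Eisenstein series: `a = ĥ`, `Λ = Λ_g` of ★ P3-D, `V z = (z−2)•vX z`, `e = 𝟙`, and `Λ_g 𝟙 = ∫ h = ĥ(0) = ĥ(2)` — the symmetry of the spherical transform), then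
`F(ρ₀) = κ`. [cite: BernsteinLapid2019, §4 p. 10] [cite: MoeglinWaldspurger1995, IV.1.11] -/
theorem value_eq_of_repr_of_tendsto {H : Type*} [NormedAddCommGroup H] [NormedSpace ℂ H] (Λ : H →L[ℂ] ℂ) {a F : ℂ → ℂ} {V : ℂ → H} {ρ₀ κ : ℂ} {w e : H}
    (ha : ContinuousAt a ρ₀) (ha0 : a ρ₀ ≠ 0) (hF : ContinuousAt F ρ₀) (hV : Tendsto V (𝓝[≠] ρ₀) (𝓝 w))
    (hrepr : ∀ᶠ z in 𝓝[≠] ρ₀, a z * F z = Λ (V z)) (hw : w = κ • e) (hsym : Λ e = a ρ₀) : F ρ₀ = κ := by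
  have h1 : Tendsto (fun z => a z * F z) (𝓝[≠] ρ₀) (𝓝 (a ρ₀ * F ρ₀)) := (ha.tendsto.mul hF.tendsto).mono_left nhdsWithin_le_nhds
  have h2 : Tendsto (fun z => Λ (V z)) (𝓝[≠] ρ₀) (𝓝 (Λ w)) := (Λ.continuous.tendsto w).comp hV
  have h3 : a ρ₀ * F ρ₀ = Λ w := tendsto_nhds_unique (h1.congr' hrepr) h2
  rw [hw, map_smul, hsym, smul_eq_mul, mul_comm κ] at h3
  exact mul_left_cancel₀ ha0 h3

end Pointwise

/-! ## §4 The CM print: the letter `hres` of ★ `hreg_cm_three_of_letters`, with «cusp forms have mean zero» DISCHARGED (★ ROAD B) -/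

section CM

variable (L : Type) [Field L] [NumberField L] [IsCMField L]
variable [MeasurableSpace (quasiSplit (↥(maximalRealSubfield L)) L (IsCMField.complexConj L) 3).Adelic] [BorelSpace (quasiSplit (↥(maximalRealSubfield L)) L (IsCMField.complexConj L) 3).Adelic]

/-- **(RES) FOR `U(2,1)_{L∕L⁺}` — THE RESIDUE AT `z = 2` IS THE CONSTANT `φ₀·r`, SO THE REMAINDER IS REGULAR AT `2`** (the binder `hres` of ★ `hreg_cm_three_of_letters`, bytes verbatim).
LETTERS (payers): (L3) `hchol hcres` (W5₃-B); (F) per `g`, `F g` analytic at `2` with `F g =ᶠ[𝓝[≠] 2] (z−2)·Ec z g` (★ bricks + the Maass–Selberg bound near `2`, operator road (66)); the residue CLASS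
`Fres ∈ L²(𝔛)` with `Fres ⊥` every cusp form (continuation of ★ P7 FILE A's `⟪E(z), φ⟫ = 0` from `{2 < re}`) and `Fres − (φ₀r)·𝟙 ∈ L²_cusp` (continued constant term (E3′) + ★ density — §2
`mem_of_orthogonal_eq_topologicalClosure_span` reduces it to orthogonality to the pseudo-Eisenstein classes); the LINK per `g`: a bounded functional `Λ` (★ P3-D `Λ_g`), a scalar `a` (★ P5 `ĥ`)
continuous and non-zero at `2`, an `L²`-valued `V` (`(z−2)•vX z`, (38b)∕(60)) tending to `Fres` along `𝓝[≠] 2`, the representation `a z·F g z = Λ (V z)` near `2`, and the symmetry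
`hsym : Λ 𝟙 = a 2` (`∫ h = ĥ(0) = ĥ(2)`); (μ-side) an automorphic `μ` and parabolic data `𝔓` with `𝔓.radical i = N(𝔸)` — «CUSP FORMS HAVE MEAN ZERO» is then ★
`integral_eq_zero_of_mem_cuspForms_cm_three` (ROAD B, this seat), no letter. [cite: Langlands1976, §7] [cite: MoeglinWaldspurger1995, IV.1.11 and IV.3.12] [cite: BernsteinLapid2019, §4 p. 10] -/
theorem hres_cm_three_of_letters
    (μ : Measure (quasiSplit (↥(maximalRealSubfield L)) L (IsCMField.complexConj L) 3).automorphicQuotient) [(quasiSplit (↥(maximalRealSubfield L)) L (IsCMField.complexConj L) 3).IsAutomorphicMeasure μ]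
    (𝔓 : (quasiSplit (↥(maximalRealSubfield L)) L (IsCMField.complexConj L) 3).ParabolicUnipotentData) (i : 𝔓.ι)
    (h𝔓 : 𝔓.radical i = adelicUnipotent (↥(maximalRealSubfield L)) L (IsCMField.complexConj L) 3)
    (φ₀ : ℂ) {cc : ℂ → ℂ} {r : ℂ} (hchol : DifferentiableOn ℂ cc ({z : ℂ | 1 < z.re} \ {2})) (hcres : Tendsto (fun z : ℂ => (z - 2) * cc z) (𝓝[≠] 2) (𝓝 r))
    (Ec : ℂ → (quasiSplit (↥(maximalRealSubfield L)) L (IsCMField.complexConj L) 3).Adelic → ℂ)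
    (F : (quasiSplit (↥(maximalRealSubfield L)) L (IsCMField.complexConj L) 3).Adelic → ℂ → ℂ) (hF : ∀ g, AnalyticAt ℂ (F g) 2)
    (hFE : ∀ g, F g =ᶠ[𝓝[≠] 2] fun z => (z - 2) * Ec z g)
    (Fres : (quasiSplit (↥(maximalRealSubfield L)) L (IsCMField.complexConj L) 3).L2 μ)
    (horth : ∀ φ : ↥((quasiSplit (↥(maximalRealSubfield L)) L (IsCMField.complexConj L) 3).cuspForms μ 𝔓),
      ⟪Fres, (quasiSplit (↥(maximalRealSubfield L)) L (IsCMField.complexConj L) 3).cuspFormsToLp μ 𝔓 φ⟫_ℂ = 0)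
    (hcusp : Fres - (φ₀ * r) • (Lp.const 2 μ (1 : ℂ) : (quasiSplit (↥(maximalRealSubfield L)) L (IsCMField.complexConj L) 3).L2 μ) ∈
      ((quasiSplit (↥(maximalRealSubfield L)) L (IsCMField.complexConj L) 3).cuspidalSubspace μ 𝔓).toSubmodule)
    (hlink : ∀ g : (quasiSplit (↥(maximalRealSubfield L)) L (IsCMField.complexConj L) 3).Adelic,
      ∃ (Λ : (quasiSplit (↥(maximalRealSubfield L)) L (IsCMField.complexConj L) 3).L2 μ →L[ℂ] ℂ) (a : ℂ → ℂ)
        (V : ℂ → (quasiSplit (↥(maximalRealSubfield L)) L (IsCMField.complexConj L) 3).L2 μ),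
        ContinuousAt a 2 ∧ a 2 ≠ 0 ∧ Tendsto V (𝓝[≠] 2) (𝓝 Fres) ∧ (∀ᶠ z in 𝓝[≠] (2 : ℂ), a z * F g z = Λ (V z)) ∧
          Λ (Lp.const 2 μ (1 : ℂ) : (quasiSplit (↥(maximalRealSubfield L)) L (IsCMField.complexConj L) 3).L2 μ) = a 2) :
    ∀ g : (quasiSplit (↥(maximalRealSubfield L)) L (IsCMField.complexConj L) 3).Adelic, ∃ G : ℂ → ℂ, AnalyticAt ℂ G 2 ∧ G =ᶠ[𝓝[≠] 2] (fun z => Ec z g -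
      φ₀ * ((((borelHeight g : ℝ≥0) : ℝ) : ℂ) ^ z + cc z * (((borelHeight g : ℝ≥0) : ℝ) : ℂ) ^ ((2 : ℂ) - z))) := by
  -- «cusp forms have mean zero» (★ ROAD B), hence `Fres = (φ₀ r)·𝟙` in `L²`
  have hmean := integral_eq_zero_of_mem_cuspForms_cm_three L μ 𝔓 i h𝔓
  have hres_class : Fres = (φ₀ * r) • (Lp.const 2 μ (1 : ℂ) : (quasiSplit (↥(maximalRealSubfield L)) L (IsCMField.complexConj L) 3).L2 μ) :=
    eq_smul_const_of_mem_orthogonal_of_sub_mem _ μ 𝔓 hmean (mem_orthogonal_cuspidalSubspace_of_forall_inner_eq_zero _ μ 𝔓 Fres horth) hcusp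
  -- the open half-plane is a neighbourhood of `2`
  have hU : {z : ℂ | 1 < z.re} ∈ 𝓝 (2 : ℂ) := (isOpen_lt continuous_const Complex.continuous_re).mem_nhds (by show (1 : ℝ) < (2 : ℂ).re; norm_num)
  intro g
  obtain ⟨Λ, a, V, ha, ha0, hV, hrepr, hsym⟩ := hlink g
  -- the pointwise residue `F g 2 = φ₀·r`
  have hval : F g 2 = φ₀ * r := value_eq_of_repr_of_tendsto Λ ha ha0 (hF g).continuousAt hV hrepr hres_class hsym
  exact exists_analyticAt_eventuallyEq_remainder_of_residue φ₀ (NNReal.coe_pos.2 (borelHeight_pos g)) (hF g) (hFE g) hval hU hchol hcres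

end CM

end Summit.HodgeConjecture.HodgeConjecture.Cruxes.H413.K2E1SphericalEisensteinResidueConstantCMThreeOfLetters

end
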